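import Summits.QuantumFields.BalabanUV.Beta.GAN24.FibreDetStrip
import Summits.QuantumFields.BalabanUV.Beta.GAN24.ArrowAnchorZero
import Summits.QuantumFields.BalabanUV.Beta.GAN24.StripLegUnits
import Summits.QuantumFields.BalabanUV.Beta.GAN24.StripRegularPackaging
import Summits.QuantumFields.BalabanUV.Beta.GAN24.ConvCKOfShapes

/-!
# `BalabanUV.Beta.GAN24.FibreStripOfRows` — binder row G-an2-4 / (CONV-C), road P1-fibre, row **P1-L10** `FibreStrip` ((I3′)), cut «(M4) scaled alias-space
# Neumann, two anchors» = SKELETON-P1 A5 v0.3, module **F9a**: (I3′) AS A FUNCTION OF THE THREE REMAINING ROWS F4 / F5 / F6 —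
# the owner's assembly with every landed input plugged BY NAME (F1 currency, F3 `ArrowAnchorZero`, F7 `FibreDetStrip`, F8 `StripLegUnits`, Y10r packaging)

NOT IN PRINT; OUR PROOF (bookkeeping; [folklore]).  HONEST FRAMING (cell contract, verbatim): «discharging `BetaPertH` makes Bałaban's UV stability UNCONDITIONAL
— a real constructive-QFT result; it is NOT the continuum limit and NOT the Clay problem.»  HONEST DEPENDENCY (verbatim): «continuum YM on T⁴ ⇐ BetaPertH ∧
nine spine estimates (0/9 proved); BetaPertH ⇐ (D1) ∧ (D4) ∧ CAP+tail; G-an2-4 gates asym, D1 and NE2/3/4.»  The three analytic inputs F4 (inner Lipschitz),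
F5 (outer anchor), F6 (outer Lipschitz) are explicit `∀`-HYPOTHESES here in EXACTLY the binder shapes of `FibreDetStrip.detStrip_of_rows`; nothing is minted; the
file `GAN24/FibreStrip.lean` (F9) is the one-line instantiation once they land.  Nothing of the K-slot of (CONV-C) is discharged here; NOT summit progress.

## Contents (`d = 3`, `D = 4` for (U2) — the only dimension in which the tree's units `sfStep = M`, `smStep 3 = M⁴` make the leg products `N`-free; (U1) is general)
§1 THE REAL WEIGHT VECTORS `sigR/rhoR` of the cut's scaling (`ArrowScaling.colLoc/colBor/rowLoc/rowBor`), `arrowMat (scaledArrow N r r₀ p) = D_ρ · arrowMat (aliasArrow N p) · D_σ`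
   in real-diagonal form, and the SQUARED A-PRIORI FORM of F8 (`StripLegReadout.apriori_sq_of_scaled_inv`) from an inverse bound of the scaled matrix.
§2 (U2) AT ONE STRIP POINT from an inverse bound of a scaled matrix with radii `r` (`r_m² ≥ 4` off the zero alias, `r 0 = r₀ > 0`): `StripLegUnits.norm_kFibΔ_le_sqrt_cstSq`
   with the slot-weight bounds of the cut DISCHARGED (`σ_A = 1`, `σ_φ = r₀²/N³`, `ρ_EL(0) = N²/r₀²`, `ρ_EL(m ≠ 0) ≤ N²/4`, `ρ_Q = N⁻⁵`).
§3 THE ZERO-ALIAS RADIUS ENVELOPE on the outer region: `ρ₀/π ≤ radO N q 0 ≤ 2π` for `q ∈ BZ 4` with `∃ μ, ρ₀/2 ≤ |q μ|` (Jordan, `SymbolTaylor.two_sided_sq_mul_lapSym`).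
§4 **`stripRegularK_of_rows`** / **`fibreStrip_of_rows`**: `∃ κ, 0 < κ ∧ ∃ Cst, StripRegularK 3 Lc κ Cst` from (hF4, hF5, hF6) — via `exists_radii`, `detStrip_of_rows`,
   `apriori_of_rows_step`, §2, §3, `cstSq_mono`, and `StripRegularPackaging.stripRegularK_of_det_bound`.
-/

noncomputable section

open Matrix Complex Finset
open scoped Matrix.Norms.L2Operator Real BigOperators
open Literature.MathematicalPhysics.QuantumFieldTheory
open Literature.MathematicalPhysics.QuantumFieldTheory.Balaban1983to89
open Literature.MathematicalPhysics.QuantumFieldTheory.Balaban1983to89.Beta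
open Literature.Probability.LatticeModels (TorusSite)
open B4Strip (Strip reVec ofRealVec)
open B4ContourShift (BZ)
open BlochFibreMatrix (stencil pieceMatrix)
open FibreInverseDecay (trigPolySymbol reVec_mem_BZ)
open OneStepResolventKernel (Fib)
open Summit.QuantumFields.BalabanUV.Beta.GAN24.CombesThomas (sfStep smStep)
open Summit.QuantumFields.BalabanUV.Beta.GAN24.CombesThomasFibreStep (kFibΔ)
open Summit.QuantumFields.BalabanUV.Beta.GAN24.ConvCKOfShapes (StripRegularK)
open Summit.QuantumFields.BalabanUV.Beta.GAN24.StripRegularPackaging (stripRegularK_of_det_bound)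
open Summit.QuantumFields.BalabanUV.Beta.GAN24.AliasWeights (kfine)
open Summit.QuantumFields.BalabanUV.Beta.GAN24.AliasWeightsSum (lapR four_le_sq_mul_lapR)
open Summit.QuantumFields.BalabanUV.Beta.GAN24.ArrowOperator
open Summit.QuantumFields.BalabanUV.Beta.GAN24.ArrowScaling
open Summit.QuantumFields.BalabanUV.Beta.GAN24.ArrowAnchorZero (isUnit_innerArrow_zero radI_zero)
open Summit.QuantumFields.BalabanUV.Beta.GAN24.FibreDetStripOfAnchors (exists_radii)
open Summit.QuantumFields.BalabanUV.Beta.GAN24.FibreDetStrip (detStrip_of_rows apriori_of_rows_step mem_BZ_of_abs_le_pi abs_le_pi_of_mem_BZ)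
open Summit.QuantumFields.BalabanUV.Beta.GAN24.StripLegReadout (apriori_sq_of_scaled_inv)
open Summit.QuantumFields.BalabanUV.Beta.GAN24.StripLegUnits (cstSq cstSq_nonneg cstSq_mono norm_kFibΔ_le_sqrt_cstSq)

namespace Summit.QuantumFields.BalabanUV.Beta.GAN24.FibreStripOfRows

/-! ## §1 Real weight vectors and the squared a-priori form -/

section Weights

variable {D N : ℕ} [NeZero N]

/-- [folklore] The REAL column weights of the cut on `AIdx` (A-slots `1`, μ-slots `N/r_m`, φ-slots `r₀²/N³`, c-slot `r₀³/N³`). -/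
def sigR (N : ℕ) (r : TorusSite D N → ℝ) (r0 : ℝ) : AIdx D (TorusSite D N) → ℝ :=
  Sum.elim (fun i => colLoc N r i.2 i.1) (colBor N r0)

/-- [folklore] The REAL row weights of the cut on `AIdx` (EL rows `N²/r_m²`, G rows `N³/r_m³`, Q rows `N^{−(D+1)}`, M row `r₀/N^{D+1}`). -/
def rhoR (N : ℕ) (r : TorusSite D N → ℝ) (r0 : ℝ) : AIdx D (TorusSite D N) → ℝ :=
  Sum.elim (fun i => rowLoc N r i.2 i.1) (rowBor D N r0)

omit [NeZero N] in
/-- [folklore] F1c's complex column weights are the casts of `sigR`. -/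
theorem colVec_eq (r : TorusSite D N → ℝ) (r0 : ℝ) : colVec (colLoc N r) (colBor N r0) = fun i => ((sigR N r r0 i : ℝ) : ℂ) := by
  funext i; rcases i with ⟨s, m⟩ | s <;> rfl

omit [NeZero N] in
/-- [folklore] F1c's complex row weights are the casts of `rhoR`. -/
theorem rowVec_eq (r : TorusSite D N → ℝ) (r0 : ℝ) : rowVec (rowLoc N r) (rowBor D N r0) = fun i => ((rhoR N r r0 i : ℝ) : ℂ) := by
  funext i; rcases i with ⟨s, m⟩ | s <;> rfl

/-- [folklore] **THE SCALED MATRIX IN REAL-DIAGONAL FORM**: `arrowMat (scaledArrow N r r₀ p) = D_ρ · arrowMat (aliasArrow N p) · D_σ`. -/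
theorem arrowMat_scaledArrow_eq (r : TorusSite D N → ℝ) (r0 : ℝ) (p : Fin D → ℂ) :
    arrowMat (scaledArrow N r r0 p) =
      diagonal (fun i => ((rhoR N r r0 i : ℝ) : ℂ)) * arrowMat (aliasArrow N p) * diagonal (fun i => ((sigR N r r0 i : ℝ) : ℂ)) := by
  rw [scaledArrow, arrowMat_scale, rowVec_eq, colVec_eq]

/-- [folklore] All column weights are positive (positive radii). -/
theorem sigR_pos {r : TorusSite D N → ℝ} (hr : ∀ m, 0 < r m) {r0 : ℝ} (hr0 : 0 < r0) (i : AIdx D (TorusSite D N)) : 0 < sigR N r r0 i := by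
  have hN : (0 : ℝ) < N := by exact_mod_cast Nat.pos_of_ne_zero (NeZero.ne N)
  rcases i with ⟨s, m⟩ | s
  · cases s <;> simp only [sigR, Sum.elim_inl, colLoc, Sum.elim_inr] <;> [exact one_pos; exact div_pos hN (hr m)]
  · cases s <;> simp only [sigR, Sum.elim_inr, colBor, Sum.elim_inl] <;> positivity

omit [NeZero N] in
/-- [folklore] A-slot column weight `= 1`. -/
theorem sigR_A (r : TorusSite D N → ℝ) (r0 : ℝ) (m : TorusSite D N) (κ : Fin D) : sigR N r r0 (Sum.inl (Sum.inl κ, m)) = 1 := rfl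

omit [NeZero N] in
/-- [folklore] φ-slot column weight `= r₀²/N³`. -/
theorem sigR_phi (r : TorusSite D N → ℝ) (r0 : ℝ) (κ : Fin D) : sigR N r r0 (Sum.inr (Sum.inl κ)) = r0 ^ 2 / (N : ℝ) ^ 3 := rfl

omit [NeZero N] in
/-- [folklore] EL-row weight `= N²/r_m²`. -/
theorem rhoR_EL (r : TorusSite D N → ℝ) (r0 : ℝ) (m : TorusSite D N) (κ : Fin D) :
    rhoR N r r0 (Sum.inl (Sum.inl κ, m)) = (N : ℝ) ^ 2 / r m ^ 2 := rfl

omit [NeZero N] in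
/-- [folklore] Q-row weight `= N^{−(D+1)}`. -/
theorem rhoR_Q (r : TorusSite D N → ℝ) (r0 : ℝ) (κ : Fin D) : rhoR N r r0 (Sum.inr (Sum.inl κ)) = ((N : ℝ) ^ (D + 1))⁻¹ := rfl

/-- [folklore] **FROM AN INVERSE BOUND OF THE SCALED MATRIX TO F8's SQUARED A-PRIORI FORM** (weights `sigR/rhoR`). -/
theorem apriori_sq_of_inv_bound {r : TorusSite D N → ℝ} (hr : ∀ m, 0 < r m) {r0 : ℝ} (hr0 : 0 < r0) (p : Fin D → ℂ) {A : ℝ}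
    (hU : IsUnit (arrowMat (scaledArrow N r r0 p))) (hA : ‖(arrowMat (scaledArrow N r r0 p))⁻¹‖ ≤ A) (x : AIdx D (TorusSite D N) → ℂ) :
    ∑ i, (‖x i‖ / sigR N r r0 i) ^ 2 ≤ A ^ 2 * ∑ i, (rhoR N r r0 i * ‖(arrowMat (aliasArrow N p) *ᵥ x) i‖) ^ 2 := by
  rw [arrowMat_scaledArrow_eq] at hU hA
  exact apriori_sq_of_scaled_inv _ _ _ (fun i => (sigR_pos hr hr0 i).ne') hU hA x

end Weights

/-! ## §2 (U2) at one strip point from an inverse bound of a scaled matrix (`d = 3`) -/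

section LegBound

variable {Lc : ℕ} [NeZero Lc]

omit [NeZero Lc] in
/-- [folklore] `((Lc^(j+1) : ℕ) : ℝ) = (Lc : ℝ)^(j+1)`. -/
theorem cast_pow_succ (j : ℕ) : (((Lc ^ (j + 1) : ℕ) : ℝ)) = (Lc : ℝ) ^ (j + 1) := by push_cast; rfl

/-- [folklore] **(U2) AT ONE POINT**: on `|Im p_i| ≤ η ≤ 1/4`, `|Re p_i| ≤ π`, an inverse bound `A` of the scaled arrow matrix at `N = Lc^(j+1)` with radii `r`
(`r_m² ≥ 4` off the zero alias, `r 0 = r₀ > 0`) gives `‖kFibΔ_j … p‖ ≤ √(cstSq A η Lc r₀)` (F8 `norm_kFibΔ_le_sqrt_cstSq` with the cut's weights DISCHARGED). -/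
theorem legBound_of_inv_bound {η A r0 : ℝ} (hη : 0 ≤ η) (hη4 : η ≤ 1 / 4) (j : ℕ) {p : Fin 4 → ℂ}
    (him : ∀ i, |(p i).im| ≤ η) (hre : ∀ i, |(p i).re| ≤ π)
    (r : TorusSite 4 (Lc ^ (j + 1)) → ℝ) (hr : ∀ m, 0 < r m) (hr4 : ∀ m, m ≠ 0 → 4 ≤ r m ^ 2) (hr0 : 0 < r0) (hr00 : r 0 = r0)
    (hU : IsUnit (arrowMat (scaledArrow (Lc ^ (j + 1)) r r0 p))) (hA : ‖(arrowMat (scaledArrow (Lc ^ (j + 1)) r r0 p))⁻¹‖ ≤ A)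
    (a b : Fib 3) (x' y' : Fin 4 → ℤ) :
    ‖kFibΔ Lc (sfStep Lc) (smStep 3 Lc) j a x' b y' p‖ ≤ Real.sqrt (cstSq A η Lc r0) := by
  have hN : (0 : ℝ) < ((Lc ^ (j + 1) : ℕ) : ℝ) := by exact_mod_cast Nat.pos_of_ne_zero (NeZero.ne _)
  refine norm_kFibΔ_le_sqrt_cstSq hη hη4 hr0 j him hre (sigR (Lc ^ (j + 1)) r r0) (rhoR (Lc ^ (j + 1)) r r0) (sigR_pos hr hr0)
    (fun m κ => by rw [sigR_A]) (fun κ => by rw [sigR_phi, cast_pow_succ]) (fun κ => ?_) (fun m hm κ => ?_) (fun κ => ?_)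
    (apriori_sq_of_inv_bound hr hr0 p hU hA) a b x' y'
  · rw [rhoR_EL, hr00, cast_pow_succ, abs_of_nonneg (by positivity)]
  · rw [rhoR_EL, cast_pow_succ, abs_of_nonneg (by positivity)]
    exact div_le_div_of_nonneg_left (by positivity) (by norm_num) (hr4 m hm)
  · rw [rhoR_Q, cast_pow_succ, abs_of_nonneg (by positivity)]

/-- [folklore] The INNER radii satisfy the hypotheses of `legBound_of_inv_bound` with `r₀ = 1`. -/
theorem radI_hyps {N : ℕ} [NeZero N] : (∀ m : TorusSite 4 N, 0 < radI N m) ∧ (∀ m : TorusSite 4 N, m ≠ 0 → 4 ≤ radI N m ^ 2) ∧ radI N (0 : TorusSite 4 N) = 1 :=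
  ⟨radI_pos, fun m hm => by rw [sq_radI hm]; exact four_le_sq_mul_lapR (fun i => by simp [Real.pi_pos.le]) hm, radI_zero⟩

/-- [folklore] The OUTER radii at `q ∈ BZ 4 ∖ {0}` satisfy the hypotheses of `legBound_of_inv_bound` with `r₀ = radO N q 0`. -/
theorem radO_hyps {N : ℕ} [NeZero N] {q : Fin 4 → ℝ} (hq : q ∈ BZ 4) (hq0 : q ≠ 0) :
    (∀ m : TorusSite 4 N, 0 < radO N q m) ∧ (∀ m : TorusSite 4 N, m ≠ 0 → 4 ≤ radO N q m ^ 2) :=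
  ⟨radO_pos (abs_le_pi_of_mem_BZ hq) hq0, fun m hm => by rw [sq_radO]; exact four_le_sq_mul_lapR (abs_le_pi_of_mem_BZ hq) hm⟩

end LegBound

/-! ## §3 The zero-alias radius envelope on the outer region -/

section Envelope

variable {N : ℕ} [NeZero N]

omit [NeZero N] in
/-- [folklore] `radO N q 0 ^ 2 = Σ_κ N²·4 sin²(q_κ/(2N))` (the zero alias: `kfine N q 0 = q/N`). -/
theorem sq_radO_zero (q : Fin 4 → ℝ) : radO N q 0 ^ 2 = ∑ κ, (N : ℝ) ^ 2 * (4 * Real.sin (q κ / (2 * N)) ^ 2) := by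
  rw [sq_radO, lapR, Finset.mul_sum]
  refine Finset.sum_congr rfl fun κ _ => ?_
  have e : kfine N q 0 κ / 2 = q κ / (2 * N) := by simp [kfine]; ring
  rw [e]

omit [NeZero N] in
/-- [folklore] `0 ≤ radO`. -/
theorem radO_nonneg (q : Fin 4 → ℝ) (m : TorusSite 4 N) : 0 ≤ radO N q m := mul_nonneg (Nat.cast_nonneg _) (Real.sqrt_nonneg _)

/-- [folklore] **UPPER ENVELOPE**: `radO N q 0 ≤ 2π` for `q ∈ BZ 4` (`N²·4sin²(q/(2N)) ≤ q² ≤ π²`, four coordinates). -/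
theorem radO_zero_le {q : Fin 4 → ℝ} (hq : q ∈ BZ 4) : radO N q 0 ≤ 2 * π := by
  have hN : (N : ℝ) ≠ 0 := by exact_mod_cast NeZero.ne N
  have hsq : radO N q 0 ^ 2 ≤ (2 * π) ^ 2 := by
    rw [sq_radO_zero]
    calc ∑ κ, (N : ℝ) ^ 2 * (4 * Real.sin (q κ / (2 * N)) ^ 2) ≤ ∑ κ : Fin 4, q κ ^ 2 :=
          Finset.sum_le_sum fun κ _ => SymbolTaylor.sq_mul_four_sin_sq_le_sq hN (q κ)
      _ ≤ ∑ _κ : Fin 4, π ^ 2 := Finset.sum_le_sum fun κ _ => by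
          have h := abs_le_pi_of_mem_BZ hq κ
          exact sq_le_sq' (abs_le.1 h).1 (abs_le.1 h).2
      _ = (2 * π) ^ 2 := by simp; ring
  exact (pow_le_pow_iff_left₀ (radO_nonneg q 0) (by positivity) two_ne_zero).1 hsq

/-- [folklore] **LOWER ENVELOPE** on the outer region: `ρ₀/π ≤ radO N q 0` when `q ∈ BZ 4`, `0 < ρ₀` and `ρ₀/2 ≤ |q μ|` for some `μ` (Jordan). -/
theorem le_radO_zero {q : Fin 4 → ℝ} (hq : q ∈ BZ 4) {ρ₀ : ℝ} (hρ₀ : 0 < ρ₀) (hfar : ∃ μ, ρ₀ / 2 ≤ |q μ|) : ρ₀ / π ≤ radO N q 0 := by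
  obtain ⟨μ, hμ⟩ := hfar
  have hN : (0 : ℝ) < N := by exact_mod_cast Nat.pos_of_ne_zero (NeZero.ne N)
  have hqμ : |q μ| ≤ π * N :=
    (abs_le_pi_of_mem_BZ hq μ).trans (le_mul_of_one_le_right Real.pi_pos.le (by exact_mod_cast Nat.one_le_iff_ne_zero.2 (NeZero.ne N)))
  have hj := SymbolTaylor.jordan_sq_mul_four_sin_sq hN hqμ
  have hsq : (ρ₀ / π) ^ 2 ≤ radO N q 0 ^ 2 := by
    rw [sq_radO_zero]
    calc (ρ₀ / π) ^ 2 = 4 / π ^ 2 * (ρ₀ / 2) ^ 2 := by field_simp; ring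
      _ ≤ 4 / π ^ 2 * q μ ^ 2 := by
          refine mul_le_mul_of_nonneg_left ?_ (by positivity)
          have h0 : 0 ≤ ρ₀ / 2 := by positivity
          calc (ρ₀ / 2) ^ 2 ≤ |q μ| ^ 2 := pow_le_pow_left₀ h0 hμ 2
            _ = q μ ^ 2 := sq_abs _
      _ ≤ (N : ℝ) ^ 2 * (4 * Real.sin (q μ / (2 * N)) ^ 2) := hj
      _ ≤ ∑ κ, (N : ℝ) ^ 2 * (4 * Real.sin (q κ / (2 * N)) ^ 2) :=
          Finset.single_le_sum (f := fun κ => (N : ℝ) ^ 2 * (4 * Real.sin (q κ / (2 * N)) ^ 2)) (fun κ _ => by positivity) (Finset.mem_univ μ)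
  exact (pow_le_pow_iff_left₀ (by positivity) (radO_nonneg q 0) two_ne_zero).1 hsq

end Envelope

/-! ## §4 (I3′) as a function of rows F4, F5, F6 -/

section Assembly

variable {Lc : ℕ} [NeZero Lc]

/-- [folklore] The explicit OUTER ENVELOPE of F8's squared constant at `A = 2·aR`, zero-alias radius range `[ρ₀/π, 2π]` (`cstSq_mono`). -/
def envOut (aR κ : ℝ) (Lc : ℕ) (ρ₀ : ℝ) : ℝ :=
  (2 * aR) ^ 2 * (Real.exp (κ * (4 * Lc)) ^ 4 * ((6 : ℝ) ^ 10 * (5 : ℝ) ^ 4 * (Lc : ℝ) ^ 12) * ((ρ₀ / π)⁻¹ ^ 4 + 39)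
    + Real.exp (κ * (4 * Lc)) ^ 2 * ((6 : ℝ) ^ 5 * (5 : ℝ) ^ 4) * ((Lc : ℝ) ^ 2)⁻¹
    + Real.exp (κ * (4 * Lc)) ^ 2 * (6 : ℝ) ^ 5 * (1 + 39 * (2 * π) ^ 4) * ((Lc : ℝ) ^ 2)⁻¹
    + (2 * π) ^ 4 * ((Lc : ℝ) ^ 16)⁻¹)

/-- [folklore] THE UNIFORM CONSTANT of (U2): inner contribution `√(cstSq 5 κ Lc 1)` (`A = 2·aZ`, `aZ = 5/2`, `r₀ = 1`) ⊔ outer envelope. -/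
def cstU (aR κ : ℝ) (Lc : ℕ) (ρ₀ : ℝ) : ℝ := max (Real.sqrt (cstSq (2 * (5 / 2)) κ Lc 1)) (Real.sqrt (envOut aR κ Lc ρ₀))

/-- [folklore] **(I3′) AS A FUNCTION OF ROWS F4 / F5 / F6** (binder shapes EXACTLY those of `FibreDetStrip.detStrip_of_rows`, with F3 = `ArrowAnchorZero.isUnit_innerArrow_zero`
plugged, `aZ = 5/2`): there are `κ > 0` and `Cst` with `StripRegularK 3 Lc κ Cst`.  `ω`/`Ω`: the outer Lipschitz modulus and its bound on `{∃ μ, ρ₀/2 ≤ |q μ|}`. -/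
theorem fibreStrip_of_rows {aR cIn cOut ρ₁ η₁ : ℝ} (ω : (Fin 4 → ℝ) → ℝ) (Ω : ℝ → ℝ)
    (hF4 : ∀ (j : ℕ) (p : Fin (3 + 1) → ℂ) (r : ℝ), (∀ μ, ‖p μ‖ ≤ r) → r ≤ ρ₁ →
      ‖arrowMat (innerArrow (Lc ^ (j + 1)) p) - arrowMat (innerArrow (Lc ^ (j + 1)) 0)‖ ≤ cIn * r)
    (hF5 : ∀ (j : ℕ), ∀ q ∈ BZ (3 + 1), q ≠ 0 → IsUnit (arrowMat (outerArrow (Lc ^ (j + 1)) q (ofRealVec q))) ∧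
      ‖(arrowMat (outerArrow (Lc ^ (j + 1)) q (ofRealVec q)))⁻¹‖ ≤ aR)
    (hF6 : ∀ (j : ℕ), ∀ q ∈ BZ (3 + 1), q ≠ 0 → ∀ p : Fin (3 + 1) → ℂ, reVec p = q → ∀ η : ℝ, 0 ≤ η → η ≤ η₁ → (∀ μ, |(p μ).im| ≤ η) →
      ‖arrowMat (outerArrow (Lc ^ (j + 1)) q p) - arrowMat (outerArrow (Lc ^ (j + 1)) q (ofRealVec q))‖ ≤ cOut * η * ω q)
    (hω : ∀ ρ₀ : ℝ, 0 < ρ₀ → ∀ q ∈ BZ (3 + 1), (∃ μ, ρ₀ / 2 ≤ |q μ|) → ω q ≤ Ω ρ₀) (hΩ : ∀ ρ, 0 < ρ → 0 ≤ Ω ρ)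
    (haR : 0 ≤ aR) (hcIn : 0 ≤ cIn) (hcOut : 0 ≤ cOut) (hρ₁ : 0 < ρ₁) (hη₁ : 0 < η₁) :
    ∃ κ, 0 < κ ∧ ∃ Cst, StripRegularK 3 Lc κ Cst := by
  have hF3 : ∀ j : ℕ, IsUnit (arrowMat (innerArrow (Lc ^ (j + 1)) (0 : Fin (3 + 1) → ℂ))) ∧
      ‖(arrowMat (innerArrow (Lc ^ (j + 1)) (0 : Fin (3 + 1) → ℂ)))⁻¹‖ ≤ 5 / 2 := fun j => isUnit_innerArrow_zero
  have haZ : (0 : ℝ) ≤ 5 / 2 := by norm_num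
  obtain ⟨ρ₀, κ₀, hρ₀, hρ, hsmallIn, hκ₀, hκ, hκη, hsmallOut⟩ := exists_radii Ω haZ haR hcIn hcOut hρ₁ hη₁ hΩ
  set κ : ℝ := min κ₀ (1 / 4) with hκdef
  have hκpos : 0 < κ := lt_min hκ₀ (by norm_num)
  have hκle : κ ≤ κ₀ := min_le_left _ _
  have hκ4 : κ ≤ 1 / 4 := min_le_right _ _
  have hmono : ∀ p : Fin (3 + 1) → ℂ, p ∈ Strip (3 + 1) κ → p ∈ Strip (3 + 1) κ₀ := fun p hp μ => ⟨(hp μ).1, (hp μ).2.trans hκle⟩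
  -- (U1)
  have hU1 := detStrip_of_rows (d := 3) (Lc := Lc) ω hF3 hF4 hF5 hF6 (hω ρ₀ hρ₀) haZ haR hcOut hρ₀ hρ hsmallIn hκ₀.le hκ hκη hsmallOut
  -- (U2)
  have hU2 : ∀ (j : ℕ) (x' y' : Fin (3 + 1) → ℤ) (a b : Fib 3), ∀ p ∈ Strip (3 + 1) κ,
      ‖kFibΔ Lc (sfStep Lc) (smStep 3 Lc) j a x' b y' p‖ ≤ cstU aR κ Lc ρ₀ := by
    intro j x' y' a b p hp
    have him : ∀ i, |(p i).im| ≤ κ := fun i => (hp i).2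
    have hre : ∀ i, |(p i).re| ≤ π := fun i => (hp i).1
    rcases apriori_of_rows_step (d := 3) (Lc := Lc) ω hF3 hF4 hF5 hF6 (hω ρ₀ hρ₀) haZ haR hcOut hρ₀ hρ hsmallIn hκ₀.le hκ hκη
        hsmallOut j (hmono p hp) with ⟨-, hU, hA⟩ | ⟨hfar, hq0, hU, hA⟩
    · -- inner case: radii `radI`, `r₀ = 1`, `A = 2·(5/2)`
      obtain ⟨hr, hr4, hr00⟩ := radI_hyps (N := Lc ^ (j + 1))
      exact (legBound_of_inv_bound hκpos.le hκ4 j him hre (radI (Lc ^ (j + 1))) hr hr4 one_pos hr00 hU hA a b x' y').trans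
        (le_max_left _ _)
    · -- outer case: anchor `q = reVec p ∈ BZ ∖ {0}`, radii `radO N q`, `r₀ = radO N q 0 ∈ [ρ₀/π, 2π]`, `A = 2·aR`
      have hq : reVec p ∈ BZ (3 + 1) := reVec_mem_BZ hp
      obtain ⟨hr, hr4⟩ := radO_hyps (N := Lc ^ (j + 1)) hq hq0
      have h1 := legBound_of_inv_bound hκpos.le hκ4 j him hre (radO (Lc ^ (j + 1)) (reVec p)) hr hr4 (hr 0) rfl hU hA a b x' y'
      refine h1.trans ((Real.sqrt_le_sqrt ?_).trans (le_max_right _ _))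
      have hlo : ρ₀ / π ≤ radO (Lc ^ (j + 1)) (reVec p) 0 := le_radO_zero hq hρ₀ hfar
      have hhi : radO (Lc ^ (j + 1)) (reVec p) 0 ≤ 2 * π := radO_zero_le hq
      exact cstSq_mono (A := 2 * aR) (η := κ) (Lc := Lc) (by positivity) hlo hhi
  exact ⟨κ, hκpos, cstU aR κ Lc ρ₀, stripRegularK_of_det_bound hκpos.le (fun j p hp => hU1 j p (hmono p hp)) hU2⟩

end Assembly

end Summit.QuantumFields.BalabanUV.Beta.GAN24.FibreStripOfRows

end
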